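/-
Origin: expansion seat `planner-pub-hodgecm-pohl-g5-0`, handover #3 2026-08-18T05:34:03Z (`HOME/pub-hodgecm-pohl-g5/lean/Pohl5/ToyDegreeZero.lean`, md5 13d9a21a, 74 lines);
landed by the gen-6 packager in gate run 23 as `HodgeCM/Model/Toy/DegreeZero.lean` (import ^import Pohl5\.→import HodgeCM.Proofs.Pohlmann. ×1).
-/
/-
Copyright: pub-hodgecm formalisation cell (harness21, 2026). New file (not vendored).
Origin: HOME/pub-hodgecm-pohl-g5/lean/Pohl5/ToyDegreeZero.lean — session planner-pub-hodgecm-pohl-g5-0 (unit pub-hodgecm-pohl-g5),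
part (b) `PohlmannSpan`, generation 5.  Intended final place: `HodgeCM/Model/Toy/DegreeZero.lean` (module
`HodgeCM.Model.Toy.DegreeZero`; kind L5) — or appended to `HodgeCM/Model/Toy/PohlmannBasis.lean` (packager's call).  ADDITIVE.
WIP import `Pohl5.DegreeZero` = the handed-over `HodgeCM/Proofs/Pohlmann/DegreeZero.lean` (rewrite to
`import HodgeCM.Proofs.Pohlmann.DegreeZero`); `HodgeCM.Model.Toy.PohlmannBasis` (pohl-g4) and `HodgeCM.Model.Toy.Toy` v2 (toy,
`toyModel_modelAxioms`) are in the run-22 frozen set.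
-/
import Summits.HodgeConjecture.HodgeCM.Model.Toy.PohlmannBasis
import Summits.HodgeConjecture.HodgeCM.Proofs.Pohlmann.DegreeZero

/-!
# Gao–Ullmo Thm 3.1 for every `p ≥ 0` holds in the toy model — with NO hypothesis

`Proofs/Pohlmann/DegreeZero.lean` proves `PohlmannTheorem31All` (Thm 3.1 "(Pohlmann)", both sentences, every `p ≥ 0`) from
`ModelAxioms` + N1–N4 + `CMProdConnected` (`pohlmannTheorem31All_of_connected`).  In the exterior CM-model
`toyModel = toyModelWith exteriorHodgeData` (`H^k(X) = ⋀^k_ℚ L_X`) every one of these hypotheses is a kernel theorem: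
`toyModel_modelAxioms` (toy, `Model/Toy/Toy.lean`, no input), N1–N4 (pohl-g4, `Model/Toy/CupFacts.lean`), and
`CMProdConnected` — here: `dim_ℚ ⋀⁰ L = C(dim L, 0) = 1` (`finrank_coh_zero`).  Hence

* `toyModel_cmProdConnected : toyModel.CMProdConnected`,
* `toyModel_pohlmannTheorem31All : toyModel.PohlmannTheorem31All` — NO hypothesis,
* `pohlmannTheorem31All_hypotheses_consistent : ∃ U, ModelAxioms ∧ N1 ∧ N2 ∧ N3 ∧ N4 ∧ CMProdConnected`
  (pohl-g4's `p ≥ 1` print forms with the binder `M` discharged — `toyModel_pohlmannSpan'`, `toyModel_pohlmannBasis'`,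
  `toyModel_pohlmannTheorem31'` — are toy2-g2's, `Model/Toy/…OpenInputs` (run 23), and are not repeated here).

So the hypothesis set of `pohlmannTheorem31All_of_connected` is jointly satisfiable (the all-`p` theorem is not vacuous).
HONEST CAVEAT: the OTHER discharge route of `DegreeZero.lean`, `pohlmannTheorem31All_of_facts` (via F6 `Fact_weightDual`), is
NOT witnessed by this model — the toy trace is `tr := 0`, so F6 (non-degenerate trace pairings) fails in `toyModel`; that is
precisely why `CMProdConnected` is isolated as the degree-`0` input.
-/

noncomputable section

namespace HodgeCM.Toy

open Literature.AlgebraicGeometry.Motives (CMType)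

variable (D : HodgeData)

/-- `dim_ℚ H⁰(X) = 1` for every object of the exterior model (any Hodge datum): `H⁰(X) = ⋀⁰ L_X`, of dimension
`C(dim L_X, 0) = 1`. -/
theorem finrank_coh_zero (X : Obj) : Module.finrank ℚ ((toyModelWith D).Coh X 0) = 1 := by
  show Module.finrank ℚ ↥(⋀[ℚ]^0 X.L) = 1
  rw [exteriorPower.finrank_eq, Nat.choose_zero_right]

/-- **`CMProdConnected` in the exterior model** (any Hodge datum), no hypothesis. -/
theorem cmProdConnected : (toyModelWith D).CMProdConnected := fun _ _ _ => finrank_coh_zero D _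

/-- **`CMProdConnected` holds in `toyModel`.** -/
theorem toyModel_cmProdConnected : toyModel.CMProdConnected := cmProdConnected exteriorHodgeData

/-- **Gao–Ullmo Thm 3.1 (both sentences, every `p ≥ 0`) holds in the toy model, with NO hypothesis.** -/
theorem toyModel_pohlmannTheorem31All : toyModel.PohlmannTheorem31All :=
  Universe.pohlmannTheorem31All_of_connected toyModel_modelAxioms toyModel_fact_cupExterior toyModel_fact_cup_hodge
    toyModel_fact_pull_H0 toyModel_fact_hodge_F0 toyModel_cmProdConnected

/-- `dim_ℚ B^p(∏_j A_{(F,Θ_j)}) = #{Hodge weights}` in the toy model for every `p ≥ 0`, `F` Galois — no hypothesis. -/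
theorem toyModel_finrank_hodgeClassesOf_all (F : CMField) [IsGalois ℚ F] {n : ℕ} (Θ : Fin (n + 1) → CMType F) (p : ℕ) :
    Module.finrank ℚ (toyModel.hodgeClassesOf (toyModel.cmProd F Θ) p) =
      Nat.card {S : Fin (n + 1) → Finset ((F : Type) →+* ℂ) // IsHodgeWeight Θ p S} :=
  (toyModel_pohlmannTheorem31All F ‹_› n Θ p).2

/-- Consistency of the hypothesis set of `Universe.pohlmannTheorem31All_of_connected`. -/
theorem pohlmannTheorem31All_hypotheses_consistent :
    ∃ U : Universe, U.ModelAxioms ∧ U.Fact_cupExterior ∧ U.Fact_cup_hodge ∧ U.Fact_pull_H0 ∧ U.Fact_hodge_F0 ∧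
      U.CMProdConnected :=
  ⟨toyModel, toyModel_modelAxioms, toyModel_fact_cupExterior, toyModel_fact_cup_hodge, toyModel_fact_pull_H0,
    toyModel_fact_hodge_F0, toyModel_cmProdConnected⟩

end HodgeCM.Toy

end
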